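import Summits.QuantumFields.YangMills.Theorems.BalabanUVNodesN07COfRecordRealSlice
import HarnessLib

/-!
# NODE N07 — THE REAL SLICE OF `C^{𝔰𝔩}` ON A NEIGHBOURHOOD: at a guarded `SU(N)` background, every jet `A′` NEAR `0` with Hermitian presented field has HERMITIAN
# values `C^{𝔰𝔩}(A′)(c)` ([15] (44), (20); [B7] (22)–(23)) — the set form of ✓`…N07COfRecordRealSlice` (which is along lines `t ↦ tA′`), i.e. the shape of the
# «`C` maps real to real» input of the `W`-row of def-Y's `ChartSUTok` reading

Cell `pub-ymgap`, width seat `pub-ymgap-dag-n07-w3` (g26), CLAIM-9.  `--kind proof --supports stmt-QuantumFields-27238 --as helper`; count-neutral.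
[15] = [Balaban1985Variational]; [B7] = [Balaban1985Averaging].

THE ARGUMENT.  As in the line version, with joint continuity: the direction map `A′ ↦ X(A′) := Ad_{U₀⁻¹}(π_𝔰𝔲(i·η_k·P A′(b)))_b` into n07's chart coordinates is continuous
(finite dimension) with `X(0) = 0`; n07-w2 ✓`eventually_smallBelow_expChart` gives the guard on a neighbourhood of `X = 0`, and 35b ✓`contDiffAt_iterM_expChart` the continuity
of `X ↦ Ū^k_h(↑(U₀·exp X))(c)`, so the argument of `log` is within `1/4` of `1` near `X = 0`; pulling both back along `A′ ↦ X(A′)` and reading, for Hermitian `A′`, the chart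
field `exp(iη_kPA′)U₀` as `↑expChart U₀ (X(A′))` (g25 ✓`coeField_expChart_adInv_eq_expOver`) gives the claim (`(log u)⋆ = −log u` by lit ✓`B7Prop2Explicit.star_mlog_eq_neg`,
the linear term by ✓`qCplxOp_star`).
* ★★★ `star_CslOfRecord_eventually_nhds` — `∀ᶠ A′ near 0, (A′ Hermitian-presented) → ∀ c, (C^{𝔰𝔩}(A′)(c))ᴴ = C^{𝔰𝔩}(A′)(c)`; `CslOfRecord_conj_eventually_nhds` (conjugation form).

HONEST LABELS.  Bookkeeping over the tree's own chart ∕ averaging ∕ logarithm; the neighbourhood is NOT quantified (no radius in terms of Bałaban's constants — that would be an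
estimate); guard displayed.  Count-neutral; N07 NOT discharged; P0 ⟨26900⟩ OPEN; R4 is the conditional finite-𝕋⁴ rung only.  Nothing here is a claim about the Yang–Mills
mass gap (`Summit.QuantumFields`): finite torus, fixed `ε`; nothing continuum ∕ OS ∕ Clay.
-/

set_option autoImplicit false

noncomputable section

open scoped Matrix Matrix.Norms.L2Operator InnerProductSpace ComplexConjugate Topology

namespace Summit.QuantumFields.YangMills.Theorems.N07COfRecordRealSliceNhds

open Filter
open Literature.MathematicalPhysics.QuantumFieldTheory.Balaban1983to89
open Literature.MathematicalPhysics.QuantumFieldTheory.Balaban1983to89.T4Continuum (T4Family)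
open T4Continuum BlockAveraging
open NormedSpace (exp)
open ExpMeanLog (expMeanLogSU)
open MatrixLog (mlog)
open B15AveragingHolomorphic (iterMh)
open B11Eq115Space (NegSize NegSup levWeight JetSup)
open B12Lemma4Models (slProj trace_slProj)
open T4AdjointCovarianceUnitary (lieSU mem_lieSU_iff specialUnitaryAd)
open Node00
open Summit.QuantumFields.YangMills.Theorems.N07ConstraintLetterTangent (I_smul_mem_lieSU coeField_expChart_adInv_eq_expOver)
open Summit.QuantumFields.YangMills.Theorems.N07RecordLettersReality (qCplxOp_star)
open Summit.QuantumFields.YangMills.Theorems.N07COfRecordRealSlice (star_evLit_slProjLit star_inv_I_smul_of_star_eq_neg mem_unitary_coe_mul_star_coe)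

variable (F : T4Family) (N : ℕ) [NeZero N] (K : ℕ) (k : ℕ) (Ω : ℕ → Set (Site (F.P K) 0)) (U₀ : GaugeField (F.P K) 0 (SU N))
  [Fact (0 < (F.L : ℝ))] [Fact (0 < (F.P K).eta k)] (levB : PBond (F.P K) k → ℕ)

/-- ★★★ **THE REAL SLICE ON A NEIGHBOURHOOD**: at a guarded background, for every `A′` near `0` whose presented field is Hermitian, every value `C^{𝔰𝔩}(A′)(c)` is Hermitian.
[cite: Balaban1985Variational, (44) p.285, (20) p.281, (19) p.281; Balaban1985Averaging, (22)–(23) p.21; Balaban1987RG1, (0.4) p.253] -/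
theorem star_CslOfRecord_eventually_nhds (hU₀ : SmallBelow (avOfRecord F N K) k U₀) :
    ∀ᶠ A in 𝓝 (0 : Space115Lit F N K k Ω U₀), (∀ b, star (evLit F N K k Ω U₀ A b) = evLit F N K k Ω U₀ A b) →
      ∀ c : PBond (F.P K) k, star (NegSup.equiv _ _ (CslOfRecord F N K k Ω U₀ levB A) c) = NegSup.equiv _ _ (CslOfRecord F N K k Ω U₀ levB A) c := by
  letI : CStarAlgebra (Matrix (Fin N) (Fin N) ℂ) := {}
  -- the direction map into n07's chart coordinates, continuous with value `0` at `0`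
  set Wmap : Space115Lit F N K k Ω U₀ → PBond (F.P K) 0 → lieSU (Fin N) := fun A b =>
    specialUnitaryAd (U₀ b)⁻¹ (suProj N (Complex.I • (((((F.P K).eta k : ℝ) : ℂ)) • evLit F N K k Ω U₀ (slProjLit F N K k Ω U₀ A) b))) with hWdef
  have hev : Continuous fun A : Space115Lit F N K k Ω U₀ => evLit F N K k Ω U₀ (slProjLit F N K k Ω U₀ A) :=
    (evLit F N K k Ω U₀).continuous_of_finiteDimensional.comp (slProjLit F N K k Ω U₀).continuous
  have hWc : Continuous Wmap := by
    refine continuous_pi fun b => ?_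
    exact (specialUnitaryAd (U₀ b)⁻¹).continuous.comp ((suProj N).continuous.comp
      ((((continuous_apply b).comp hev).const_smul ((((F.P K).eta k : ℝ) : ℂ))).const_smul Complex.I))
  have hW0 : Wmap 0 = 0 := by
    funext b
    simp only [hWdef, map_zero, Pi.zero_apply, smul_zero]
  have hWt : Tendsto Wmap (𝓝 0) (𝓝 0) := by simpa only [hW0] using hWc.tendsto 0
  -- (e1) the guard near `X = 0`; (e2) the argument of `log` near `1`
  have hev₁ : ∀ᶠ X : PBond (F.P K) 0 → lieSU (Fin N) in 𝓝 0, SmallBelow (avOfRecord F N K) k (expChart U₀ X) := eventually_smallBelow_expChart hU₀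
  have hev₂ : ∀ᶠ X : PBond (F.P K) 0 → lieSU (Fin N) in 𝓝 0, ∀ c : PBond (F.P K) k,
      ‖iterM k (coeField (expChart U₀ X)) c * star ((Averaging.iter (avOfRecord F N K) k U₀ c : SU N) : Matrix (Fin N) (Fin N) ℂ) - 1‖ < 1 / 4 := by
    refine eventually_all.2 fun c => ?_
    have hcont : ContinuousAt (fun X : PBond (F.P K) 0 → lieSU (Fin N) => iterM k (coeField (expChart U₀ X)) c *
        star ((Averaging.iter (avOfRecord F N K) k U₀ c : SU N) : Matrix (Fin N) (Fin N) ℂ) - 1) 0 :=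
      ((((continuousAt_apply c _).comp (contDiffAt_iterM_expChart (P := F.P K) hU₀).continuousAt)).mul continuousAt_const).sub continuousAt_const
    have h0 : iterM k (coeField (expChart U₀ (0 : PBond (F.P K) 0 → lieSU (Fin N)))) c *
        star ((Averaging.iter (avOfRecord F N K) k U₀ c : SU N) : Matrix (Fin N) (Fin N) ℂ) - 1 = 0 := by
      have hV0 : iterM k (coeField (expChart U₀ (0 : PBond (F.P K) 0 → lieSU (Fin N)))) c =
          ((Averaging.iter (avOfRecord F N K) k U₀ c : SU N) : Matrix (Fin N) (Fin N) ℂ) := by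
        rw [expChart_zero, ← coeField_iter_eq_iterM k hU₀]; rfl
      rw [hV0, coe_mul_star_coe_SU, sub_self]
    have htn : Tendsto (fun X : PBond (F.P K) 0 → lieSU (Fin N) => ‖iterM k (coeField (expChart U₀ X)) c *
        star ((Averaging.iter (avOfRecord F N K) k U₀ c : SU N) : Matrix (Fin N) (Fin N) ℂ) - 1‖) (𝓝 0) (𝓝 0) := by
      have h := hcont.norm.tendsto
      rwa [h0, norm_zero] at h
    exact htn.eventually (Iio_mem_nhds (by norm_num : (0 : ℝ) < 1 / 4))
  filter_upwards [hWt.eventually hev₁, hWt.eventually hev₂] with A h₁ h₂ hA c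
  -- the Hermitian traceless direction `Y = η_k·P A′` and the chart identity
  set Y : PBond (F.P K) 0 → Matrix (Fin N) (Fin N) ℂ := ((((F.P K).eta k : ℝ) : ℂ)) • evLit F N K k Ω U₀ (slProjLit F N K k Ω U₀ A) with hYdef
  have hY : ∀ b, star (Y b) = Y b := fun b => by
    rw [hYdef, Pi.smul_apply, star_smul, Complex.star_def, Complex.conj_ofReal, star_evLit_slProjLit F N K k Ω U₀ hA]
  have htr : ∀ b, (Y b).trace = 0 := fun b => by
    rw [hYdef, Pi.smul_apply, Matrix.trace_smul, evLit_slProjLit, trace_slProj, smul_zero]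
  have hWA : Wmap A = (1 : ℝ) • fun b => specialUnitaryAd (U₀ b)⁻¹ ⟨Complex.I • Y b, I_smul_mem_lieSU (hY b) (htr b)⟩ := by
    rw [one_smul]
    funext b
    simp only [hWdef]
    congr 1
    exact Subtype.ext (coe_suProj_of_mem (I_smul_mem_lieSU (hY b) (htr b)))
  have hchart : expOver U₀ ((((F.P K).eta k : ℝ) : ℂ) • evLit F N K k Ω U₀ (slProjLit F N K k Ω U₀ A)) = coeField (expChart U₀ (Wmap A)) := by
    rw [hWA, coeField_expChart_adInv_eq_expOver U₀ hY htr 1, Complex.ofReal_one, one_smul]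
  set G : Matrix (Fin N) (Fin N) ℂ := ((Averaging.iter (avOfRecord F N K) k (expChart U₀ (Wmap A)) c : SU N) : Matrix (Fin N) (Fin N) ℂ) with hG
  set V : Matrix (Fin N) (Fin N) ℂ := ((Averaging.iter (avOfRecord F N K) k U₀ c : SU N) : Matrix (Fin N) (Fin N) ℂ) with hV
  have hG' : iterM k (coeField (expChart U₀ (Wmap A))) c = G := by
    rw [← coeField_iter_eq_iterM k h₁]; rfl
  have hlog : star (mlog (G * star V)) = -mlog (G * star V) := by
    have h := h₂ c
    rw [hG'] at h
    exact B7Prop2Explicit.star_mlog_eq_neg (mem_unitary_coe_mul_star_coe _ _) h.le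
  have hlin : star (qCplxOp k U₀ (evLit F N K k Ω U₀ (slProjLit F N K k Ω U₀ A)) c) = qCplxOp k U₀ (evLit F N K k Ω U₀ (slProjLit F N K k Ω U₀ A)) c := by
    have hs : star (evLit F N K k Ω U₀ (slProjLit F N K k Ω U₀ A)) = evLit F N K k Ω U₀ (slProjLit F N K k Ω U₀ A) :=
      funext fun b => star_evLit_slProjLit F N K k Ω U₀ hA b
    rw [← qCplxOp_star hU₀, hs]
  rw [CslOfRecord_apply, COfRecord_apply, hchart, iterMh_coeField_of_smallBelow F N k _ h₁, coeField_apply, ← hG, ← hV, star_sub,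
    star_inv_I_smul_of_star_eq_neg hlog, hlin]

/-- ★★★ **THE REAL SLICE ON A NEIGHBOURHOOD, conjugation form**: near `0`, every Hermitian-presented `A′` has `C^{𝔰𝔩}(A′)` fixed by the bondwise conjugation of block fields.
[cite: Balaban1985Variational, (44) p.285, (20) p.281] -/
theorem CslOfRecord_conj_eventually_nhds (hU₀ : SmallBelow (avOfRecord F N K) k U₀) :
    ∀ᶠ A in 𝓝 (0 : Space115Lit F N K k Ω U₀), (∀ b, star (evLit F N K k Ω U₀ A b) = evLit F N K k Ω U₀ A b) →
      ((NegSup.equiv _ _).symm (star (NegSup.equiv _ _ (CslOfRecord F N K k Ω U₀ levB A))) : NegSize (F.L : ℝ) ((F.P K).eta k) levB 0 (Matrix (Fin N) (Fin N) ℂ)) =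
        CslOfRecord F N K k Ω U₀ levB A := by
  filter_upwards [star_CslOfRecord_eventually_nhds F N K k Ω U₀ levB hU₀] with A hAev hA
  apply (NegSup.equiv _ _).injective
  rw [Equiv.apply_symm_apply]
  funext c
  rw [Pi.star_apply, hAev hA c]

end Summit.QuantumFields.YangMills.Theorems.N07COfRecordRealSliceNhds

end
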